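import Mathlib
import Literature.Analysis.ValidatedNumerics.BoxCover
import HarnessLib

/-!
# Kernel face checks with PER-LEAF multipliers (LP-guided branch and bound for the S-procedure)
(helper file for crux stmt-NavierStokesRegularity-27057 `SubOnsagerCeiling.ForwardTailCeilingKP`, `--supports … --as helper`;
LEAD SOC g10, census v13 §K, line «kp-shell-barrier», virtual-floor / Ω-coupled four-window certificates)

`VirtualFloor.KernelFace.eval_lt_zero_of_kdCheck` (p687184) certifies a face condition `e < 0` on the part of a box where
the other faces' slacks `g ≥ 0` hold, by checking `e + Σ λ·g ≤ −δ` leaf by leaf with ONE global multiplier vector `λ`.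
With a single `λ` the slack terms are ADDED on every leaf, also far from where their constraints are active, so the box of a
face has to be shrunk by hand to the active region. The designs of census v13 §K.5 (ten faces, margins `0.02–0.07`
normalised, quadric floors) need the standard refinement: the multipliers are chosen PER LEAF (by a small LP or from the
sampling oracle's binding constraints), i.e. the kd-tree's leaf datum is `(precision, multipliers)`.

This file is that variant over the tree's validated-numerics layer (`Literature.Analysis.ValidatedNumerics`: `ArithExpr`,
`ArithExpr.enclose`, `Box`, `KdCert`, `KdCert.sound`, `exprLeOn`):
* `LeafMul` — leaf datum `(prec, lams)`; `mulSum lams gs` — the expression `Σᵢ λᵢ·gᵢ` (zipped; surplus entries ignored);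
* `leafCheckMul e gs b` — the leaf check «all `λᵢ ≥ 0` and the natural interval extension of `e + Σ λᵢ gᵢ` on the leaf box
  is `≤ b`», kernel-evaluable (`decide +kernel`);
* soundness: `eval_le_of_kdCheckMul` (`e ≤ b` wherever all `gᵢ ≥ 0`), `eval_lt_zero_of_kdCheckMul` (strict form with
  `b = −δ`, `δ > 0`), `eval_nonneg_of_kdCheckMul` (`0 ≤ e` form for damping-sign conditions). An equality constraint
  `h = 0` (the active face) is passed as the two slacks `h`, `−h`.
The slack list `gs` is arbitrary (`ArithExpr`), so linear facets, cubic floors, quadric floors (census §K.5) and the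
neighbour-window copies of all of them are handled uniformly; the user discharges `∀ g ∈ gs, 0 ≤ g.eval x` from the face
hypotheses by `simp` + `linarith`/`nlinarith` as in p687184's worked example.

HONEST FRAMING: plumbing (validated numerics ↔ face-certificate lemmas) towards a MODEL-lattice rung (crux
`ForwardTailCeilingKP`, route SubOnsagerCeiling, TL-M2Break); it certifies no design by itself; nothing here bears on
Navier–Stokes regularity; 27057 stays OPEN.
[cite: Moore1966, Theorem 3.1, §4.4 (inclusion property, refinement by subdivision)]
-/

-- the sub-problem namespace `NavierStokesRegularity.NavierStokesRegularity` is the tree's layout (D-0017)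
set_option linter.dupNamespace false

namespace Summit.NavierStokesRegularity.NavierStokesRegularity.Theorems.VirtualFloor.KernelFaceMul

open Literature.Analysis.ValidatedNumerics

/-- Leaf datum of a multiplier kd-tree: working precision and the multipliers of the slack terms on this leaf. [folklore] -/
structure LeafMul where
  /-- dyadic working precision of the interval evaluation on this leaf -/
  prec : ℕ
  /-- multipliers `λᵢ` of the slacks `gᵢ` on this leaf (must be `≥ 0`; missing entries count as absent terms) -/
  lams : List ℚ
  deriving Inhabited, DecidableEq

/-- The expression `Σᵢ λᵢ · gᵢ` over the zipped lists (the shorter list truncates the sum). [folklore] -/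
def mulSum : List ℚ → List ArithExpr → ArithExpr
  | [], _ => .const 0
  | lam :: ls, gs =>
    match gs with
    | [] => .const 0
    | g :: gs' => .add (.mul (.const lam) g) (mulSum ls gs')

/-- `mulSum` of an empty multiplier list. [folklore] -/
@[simp] theorem mulSum_nil_left (gs : List ArithExpr) : mulSum [] gs = .const 0 := rfl

/-- `mulSum` against an empty slack list. [folklore] -/
@[simp] theorem mulSum_nil_right (ls : List ℚ) : mulSum ls [] = .const 0 := by
  cases ls <;> rfl

/-- `mulSum` unfolds on two non-empty lists. [folklore] -/
@[simp] theorem mulSum_cons (lam : ℚ) (ls : List ℚ) (g : ArithExpr) (gs : List ArithExpr) :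
    mulSum (lam :: ls) (g :: gs) = .add (.mul (.const lam) g) (mulSum ls gs) := rfl

/-- The multiplier sum is non-negative at a point where every multiplier and every slack is non-negative. [folklore] -/
theorem eval_mulSum_nonneg (x : ℕ → ℝ) :
    ∀ (ls : List ℚ) (gs : List ArithExpr), (∀ l ∈ ls, 0 ≤ l) → (∀ g ∈ gs, 0 ≤ g.eval x) →
      0 ≤ (mulSum ls gs).eval x
  | [], gs, _, _ => by simp
  | _ :: _, [], _, _ => by simp
  | lam :: ls, g :: gs, hl, hg => by
    have h1 : (0 : ℝ) ≤ lam := by exact_mod_cast hl lam (by simp)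
    have h2 : 0 ≤ g.eval x := hg g (by simp)
    have h3 := eval_mulSum_nonneg x ls gs (fun l hl' => hl l (by simp [hl'])) (fun g' hg' => hg g' (by simp [hg']))
    simp only [mulSum_cons, ArithExpr.eval_add, ArithExpr.eval_mul, ArithExpr.eval_const]
    exact add_nonneg (mul_nonneg h1 h2) h3

/-- All entries of a list of rationals are `≥ 0` (structural, kernel-evaluable). [folklore] -/
def allNonneg : List ℚ → Bool
  | [] => true
  | l :: ls => decide (0 ≤ l) && allNonneg ls

/-- `allNonneg` is correct. [folklore] -/
theorem allNonneg_iff : ∀ ls : List ℚ, allNonneg ls = true ↔ ∀ l ∈ ls, 0 ≤ l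
  | [] => by simp [allNonneg]
  | l :: ls => by
    rw [allNonneg, Bool.and_eq_true, decide_eq_true_iff, allNonneg_iff ls]
    simp

/-- **The per-leaf multiplier leaf check** (see `allNonneg`): all multipliers of the leaf are `≥ 0` and the natural interval
extension of `e + Σ λᵢ gᵢ` on the leaf box is `≤ b` (Moore 1966, Theorem 3.1). Kernel-evaluable.
[cite: Moore1966, Theorem 3.1] -/
def leafCheckMul (e : ArithExpr) (gs : List ArithExpr) (b : ℚ) (B : Box) (d : LeafMul) : Bool :=
  allNonneg d.lams && exprLeOn (.add e (mulSum d.lams gs)) b B d.prec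

/-- Soundness of one leaf: where the slacks are non-negative, `e ≤ b`. [cite: Moore1966, Theorem 3.1] -/
theorem leafCheckMul_sound {e : ArithExpr} {gs : List ArithExpr} {b : ℚ} {B : Box} {d : LeafMul}
    (h : leafCheckMul e gs b B d = true) (x : ℕ → ℝ) (hx : B.mem x) (hg : ∀ g ∈ gs, 0 ≤ g.eval x) :
    e.eval x ≤ b := by
  rw [leafCheckMul, Bool.and_eq_true] at h
  have hl : ∀ l ∈ d.lams, (0 : ℚ) ≤ l := (allNonneg_iff d.lams).1 h.1
  have hle := exprLeOn_sound h.2 x hx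
  have hnn := eval_mulSum_nonneg x d.lams gs hl hg
  simp only [ArithExpr.eval_add] at hle
  linarith

/-- **`e ≤ b` on a box from a multiplier kd-tree**, wherever all slacks are non-negative (Moore 1966, Thm 3.1 / §4.4 on every
leaf, S-procedure per leaf). [cite: Moore1966, Theorem 3.1, §4.4] -/
theorem eval_le_of_kdCheckMul {e : ArithExpr} {gs : List ArithExpr} {b : ℚ} {B : Box} {t : KdCert LeafMul}
    (h : t.check (leafCheckMul e gs b) B = true) (x : ℕ → ℝ) (hx : B.mem x) (hg : ∀ g ∈ gs, 0 ≤ g.eval x) :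
    e.eval x ≤ b :=
  KdCert.sound (P := fun y => (∀ g ∈ gs, 0 ≤ g.eval y) → e.eval y ≤ (b : ℝ))
    (fun _ _ hl y hy hgy => leafCheckMul_sound hl y hy hgy) t B h x hx hg

/-- **Strict face condition from a multiplier kd-tree** (`b = −δ`, `δ > 0`): `e < 0` wherever the slacks are non-negative —
the shape of the INERTIAL hypotheses of `game_of_polyCert` / `window4_le_of_coupledCertB` / `window4_le_of_coupledFaceCertB'`.
[cite: Moore1966, Theorem 3.1, §4.4] -/
theorem eval_lt_zero_of_kdCheckMul {e : ArithExpr} {gs : List ArithExpr} {δ : ℚ} {B : Box} {t : KdCert LeafMul}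
    (hδ : 0 < δ) (h : t.check (leafCheckMul e gs (-δ)) B = true) (x : ℕ → ℝ) (hx : B.mem x)
    (hg : ∀ g ∈ gs, 0 ≤ g.eval x) : e.eval x < 0 := by
  have h1 := eval_le_of_kdCheckMul h x hx hg
  have hδ' : (0 : ℝ) < δ := by exact_mod_cast hδ
  have : ((-δ : ℚ) : ℝ) = -(δ : ℝ) := by push_cast; ring
  rw [this] at h1
  linarith

/-- **Non-strict form (`0 ≤ e`)** for DAMPING-SIGN hypotheses: check `−e + Σ λᵢ gᵢ ≤ 0` leaf by leaf.
[cite: Moore1966, Theorem 3.1, §4.4] -/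
theorem eval_nonneg_of_kdCheckMul {e : ArithExpr} {gs : List ArithExpr} {B : Box} {t : KdCert LeafMul}
    (h : t.check (leafCheckMul (.neg e) gs 0) B = true) (x : ℕ → ℝ) (hx : B.mem x)
    (hg : ∀ g ∈ gs, 0 ≤ g.eval x) : 0 ≤ e.eval x := by
  have h1 := eval_le_of_kdCheckMul h x hx hg
  simp only [ArithExpr.eval_neg, Rat.cast_zero] at h1
  linarith

/-- Kernel example (mechanics only; no rung is claimed). On the box `x₀ ∈ [0, 1]` the expression `e = x₀ − 1` is `< 0`
wherever the slack `g = 1/2 − x₀` is `≥ 0`; the leaves use DIFFERENT multipliers: `λ = 0` on `[0, 1/2]` (there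
`e ≤ −1/2` outright) and `λ = 1` on the two quarters of `[1/2, 1]` (there `e + g ≡ −1/2`; the natural interval extension
sees `≤ −1/4` once the leaf width is `≤ 1/4` — the dependency effect that per-leaf subdivision controls). -/
example : ∀ x : ℕ → ℝ, Box.mem [(0, 1)] x → 0 ≤ (ArithExpr.sub (.const (1 / 2)) (.var 0)).eval x →
    (ArithExpr.sub (.var 0) (.const 1)).eval x < 0 := by
  intro x hx hg
  have hcheck : (KdCert.split 0 (1 / 2) (.leaf ⟨8, [0]⟩) (.split 0 (3 / 4) (.leaf ⟨8, [1]⟩) (.leaf ⟨8, [1]⟩))).check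
      (leafCheckMul (.sub (.var 0) (.const 1)) [.sub (.const (1 / 2)) (.var 0)] (-(1 / 4))) [(0, 1)] = true := by
    decide +kernel
  exact eval_lt_zero_of_kdCheckMul (by norm_num) hcheck x hx (fun g hg' => by
    simp only [List.mem_singleton] at hg'
    subst hg'
    exact hg)

end Summit.NavierStokesRegularity.NavierStokesRegularity.Theorems.VirtualFloor.KernelFaceMul
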